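import Mathlib
import HarnessLib

/-!
# Faces of a virtual-floor game certificate: the first-exit lemma for right-differentiable barriers
(helper file for crux stmt-NavierStokesRegularity-27057 `SubOnsagerCeiling.ForwardTailCeilingKP`, `--supports … --as helper`;
LEAD SOC census v9 §G.5 / `Cruxes/ForwardTailCeilingKP/Lines/virtual-floor-game-SPEC.md`)

The game hypothesis `hGame` of `VirtualFloor.chain_shellBarrier_of_game_geom` (p664993) is to be discharged by a
ROBUST-INVARIANCE certificate: a finite family of faces `hₖ(t) = gₖ(S₀(t), …, S_{k₀}(t), y(t)) ≤ cₖ` containing the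
initial box, contained in `{maxᵢ Sᵢ < 1}`, and strictly inward on every active face. The plays of the game are only
RIGHT-differentiable (`HasDerivWithinAt … (Ici t) t` on `[0, T)`) and continuous on `[0, T]`, so the tree's two-sided
lemma `Literature.Analysis.ODE.forall_le_of_hasDerivWithinAt_of_eq_imp_deriv_neg` (derivative within `[0, T]` at every
point of `[0, T]`) does not apply verbatim. This file proves the right-derivative form once:

* `forall_le_of_hasDerivWithinAt_Ici_of_active_lt` — finitely many real functions `hₖ`, continuous on `[0, T]`, with right
  derivatives `hₖ' t` on `[0, T)`, starting below their levels, such that every ACTIVE constraint (`hₖ t = cₖ` while all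
  `hⱼ t ≤ cⱼ`) has `hₖ' t < 0`, stay below their levels on `[0, T]`.
* `forall_le_of_hasDerivWithinAt_Ici_of_active_lt_of_le` — the same when the right derivative of some constraints is only
  known up to an upper bound (the virtual floor `y` of the game has `ẏ ≥ …` only; faces are non-increasing in `y`).

HONEST FRAMING: an abstract real-analysis lemma towards a MODEL-lattice rung (crux `ForwardTailCeilingKP`, route
SubOnsagerCeiling, TL-M2Break); it certifies nothing by itself; nothing here bears on Navier–Stokes regularity; 27057 stays OPEN.
[cite: Hartman2002, Ch. III §4 Cor 4.1 (functions with a signed right derivative); LinFrancisMaggiore2007, §2.3 Lemma 2.2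
(max-type Lyapunov functions, the two-sided form in `Literature/Analysis/ODE/MaxLyapunovInvariance.lean`)]
-/

noncomputable section

-- the sub-problem namespace `NavierStokesRegularity.NavierStokesRegularity` is the tree's layout (D-0017)
set_option linter.dupNamespace false

namespace Summit.NavierStokesRegularity.NavierStokesRegularity.Theorems.VirtualFloor

open Set Filter Topology

/-- **First-exit lemma for finitely many right-differentiable barriers.** Let `hₖ : ℝ → ℝ` (`k` in a finite index
type) be continuous on `[0, T]`, have RIGHT derivatives `hₖ' t` (within `Ici t`) at every `t ∈ [0, T)`, start below
their levels (`hₖ 0 ≤ cₖ`), and satisfy the strict active-face condition on `[0, T)`: whenever all `hⱼ t ≤ cⱼ` and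
`hₖ t = cₖ`, then `hₖ' t < 0`. Then `hₖ t ≤ cₖ` for all `t ∈ [0, T]` and all `k`. Proof: the infimum `t₁` of the bad
times is good by continuity from the left; if `t₁ < T`, active constraints are `< cₖ` just after `t₁` (slope form of the
right derivative) and inactive ones by continuity, finiteness gives a common right-neighbourhood of good times — absurd.
[cite: Hartman2002, Ch. III §4 Cor 4.1; LinFrancisMaggiore2007, §2.3 Lemma 2.2] -/
theorem forall_le_of_hasDerivWithinAt_Ici_of_active_lt {ι : Type*} [Finite ι] {h h' : ι → ℝ → ℝ} {c : ι → ℝ}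
    {T : ℝ} (hcont : ∀ k, ContinuousOn (h k) (Icc 0 T))
    (hder : ∀ k, ∀ t ∈ Ico 0 T, HasDerivWithinAt (h k) (h' k t) (Ici t) t)
    (hface : ∀ t ∈ Ico 0 T, (∀ j, h j t ≤ c j) → ∀ k, h k t = c k → h' k t < 0)
    (h0 : ∀ k, h k 0 ≤ c k) : ∀ t ∈ Icc 0 T, ∀ k, h k t ≤ c k := by
  by_contra hcon
  push Not at hcon
  obtain ⟨t₂, ht₂, k₂, hk₂⟩ := hcon
  set B : Set ℝ := {t | t ∈ Icc 0 T ∧ ∃ k, c k < h k t} with hB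
  have hBne : B.Nonempty := ⟨t₂, ht₂, k₂, hk₂⟩
  have hBbdd : BddBelow B := ⟨0, fun t ht => ht.1.1⟩
  set t₁ := sInf B with ht₁
  have ht₁0 : 0 ≤ t₁ := le_csInf hBne fun b hb => hb.1.1
  have ht₁T : t₁ ≤ T := (csInf_le hBbdd ⟨ht₂, k₂, hk₂⟩).trans ht₂.2
  have ht₁I : t₁ ∈ Icc 0 T := ⟨ht₁0, ht₁T⟩
  have hcts : ∀ k, ContinuousWithinAt (h k) (Icc 0 T) t₁ := fun k => hcont k t₁ ht₁I
  -- times before `t₁` are good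
  have hgood : ∀ s ∈ Icc 0 T, s < t₁ → ∀ k, h k s ≤ c k := by
    intro s hs hst k
    by_contra hlt
    push Not at hlt
    exact absurd (csInf_le hBbdd ⟨hs, k, hlt⟩) (not_le.2 hst)
  -- hence `t₁` itself is good (continuity from the left)
  have hgood₁ : ∀ k, h k t₁ ≤ c k := by
    intro k
    rcases ht₁0.eq_or_lt with h01 | h01
    · rw [← h01]
      exact h0 k
    · have hIco : Ico 0 t₁ ⊆ Icc 0 T := fun s hs => ⟨hs.1, hs.2.le.trans ht₁T⟩
      have htend : Tendsto (h k) (𝓝[Ico 0 t₁] t₁) (𝓝 (h k t₁)) := ((hcts k).mono hIco).tendsto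
      have hcl : t₁ ∈ closure (Ico 0 t₁) := by
        rw [closure_Ico h01.ne]
        exact right_mem_Icc.2 h01.le
      haveI : (𝓝[Ico 0 t₁] t₁).NeBot := mem_closure_iff_nhdsWithin_neBot.1 hcl
      have hev : ∀ᶠ s in 𝓝[Ico 0 t₁] t₁, h k s ∈ Iic (c k) :=
        eventually_nhdsWithin_of_forall fun s hs => hgood s (hIco hs) hs.2 k
      exact isClosed_Iic.mem_of_tendsto htend hev
  -- `t₁` is not a bad time, so `t₁ < T` (a bad time `b` exists with `t₁ ≤ b ≤ T`, and `b ≠ t₁`)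
  have ht₁B : t₁ ∉ B := by
    rintro ⟨-, k, hk⟩
    exact absurd (hgood₁ k) (not_le.2 hk)
  have ht₁ltT : t₁ < T := by
    by_contra hge
    push Not at hge
    have hTeq : t₁ = T := le_antisymm ht₁T hge
    have : t₂ = t₁ := le_antisymm (hTeq ▸ ht₂.2) (csInf_le hBbdd ⟨ht₂, k₂, hk₂⟩)
    exact ht₁B (this ▸ ⟨ht₂, k₂, hk₂⟩)
  have ht₁Ico : t₁ ∈ Ico 0 T := ⟨ht₁0, ht₁ltT⟩
  -- a right-neighbourhood of `t₁` within `[0, T]` is good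
  have hafter : ∀ᶠ s in 𝓝[Icc 0 T ∩ Ioi t₁] t₁, ∀ k, h k s ≤ c k := by
    rw [Filter.eventually_all]
    intro k
    rcases (hgood₁ k).lt_or_eq with hlt | heq
    · -- inactive constraint: continuity
      have h1 : ∀ᶠ s in 𝓝[Icc 0 T] t₁, h k s ∈ Iio (c k) :=
        (hcts k).tendsto.eventually (Iio_mem_nhds hlt)
      exact (h1.filter_mono (nhdsWithin_mono _ inter_subset_left)).mono fun s hs => le_of_lt hs
    · -- active constraint: negative right derivative
      have hd : h' k t₁ < 0 := hface t₁ ht₁Ico hgood₁ k heq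
      have hsl : ∀ᶠ z in 𝓝[Ioi t₁] t₁, slope (h k) t₁ z < 0 :=
        (hder k t₁ ht₁Ico).Ioi_of_Ici.limsup_slope_le' (lt_irrefl t₁) hd
      have h2 := hsl.filter_mono (nhdsWithin_mono _ (inter_subset_right : Icc 0 T ∩ Ioi t₁ ⊆ Ioi t₁))
      filter_upwards [h2, eventually_mem_nhdsWithin] with z hz hzmem
      rw [slope_def_field] at hz
      have hpos : 0 < z - t₁ := sub_pos.2 hzmem.2
      have hnum : h k z - h k t₁ < 0 := by
        have := (div_lt_iff₀ hpos).1 hz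
        simpa using this
      linarith
  rw [eventually_nhdsWithin_iff, Metric.eventually_nhds_iff] at hafter
  obtain ⟨ε, hε, hball⟩ := hafter
  obtain ⟨b, hbB, hblt⟩ := exists_lt_of_csInf_lt hBne (show sInf B < t₁ + ε by linarith)
  have hbge : t₁ ≤ b := csInf_le hBbdd hbB
  have hbne : b ≠ t₁ := fun hbt => ht₁B (hbt ▸ hbB)
  have hbgt : t₁ < b := lt_of_le_of_ne hbge (Ne.symm hbne)
  have hdist : dist b t₁ < ε := by
    rw [Real.dist_eq, abs_of_nonneg (by linarith)]
    linarith
  obtain ⟨hbI, k, hk⟩ := hbB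
  exact absurd (hball hdist ⟨hbI, hbgt⟩ k) (not_le.2 hk)

/-- **The same with one-sided information on the derivatives.** If each `hₖ` has SOME right derivative `D` at every
`t ∈ [0, T)` with `D ≤ hₖ' t` for a given bound `hₖ'` (this is how the virtual floor `y` of the game enters a face that is
non-increasing in `y`: only `ẏ ≥ …` is known), and the strict active-face condition holds for the BOUNDS `hₖ'`, the
barriers are not crossed. [cite: Hartman2002, Ch. III §4 Cor 4.1] -/
theorem forall_le_of_hasDerivWithinAt_Ici_of_active_lt_of_le {ι : Type*} [Finite ι] {h h' : ι → ℝ → ℝ}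
    {c : ι → ℝ} {T : ℝ} (hcont : ∀ k, ContinuousOn (h k) (Icc 0 T))
    (hder : ∀ k, ∀ t ∈ Ico 0 T, ∃ D : ℝ, HasDerivWithinAt (h k) D (Ici t) t ∧ D ≤ h' k t)
    (hface : ∀ t ∈ Ico 0 T, (∀ j, h j t ≤ c j) → ∀ k, h k t = c k → h' k t < 0)
    (h0 : ∀ k, h k 0 ≤ c k) : ∀ t ∈ Icc 0 T, ∀ k, h k t ≤ c k := by
  classical
  -- choose the actual right derivatives
  have hch : ∀ k, ∀ t, ∃ D : ℝ, (t ∈ Ico 0 T → HasDerivWithinAt (h k) D (Ici t) t ∧ D ≤ h' k t) := by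
    intro k t
    by_cases ht : t ∈ Ico 0 T
    · obtain ⟨D, hD⟩ := hder k t ht
      exact ⟨D, fun _ => hD⟩
    · exact ⟨0, fun h => absurd h ht⟩
  choose D hD using hch
  refine forall_le_of_hasDerivWithinAt_Ici_of_active_lt (h' := D) hcont (fun k t ht => (hD k t ht).1)
    (fun t ht hall k hk => ?_) h0
  exact lt_of_le_of_lt ((hD k t ht).2) (hface t ht hall k hk)

end Summit.NavierStokesRegularity.NavierStokesRegularity.Theorems.VirtualFloor

end
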